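/-
Copyright: the b2b-balaban T⁴-continuum CRUX team, row NE7b, leaf prover `t4-ne7b-formalise-leaf-01` (gen 78), for the
OWNER lineage `t4-ne7b-p1` and the refuter desk (PRICING-NE7b F338 ∕ F351 ∕ F353, vacuity check 3b). Project licence.
-/
import Summits.QuantumFields.BalabanUV.T4Continuum.Spine.NE7b.LocalConditionalStability
import Summits.QuantumFields.BalabanUV.T4Continuum.Spine.NE7b.GaussianRankLocalMoment

/-!
# THE TWO HALVES OF «LCS-j» JOINTLY INHABITED BY A CONTINUUM GAUSSIAN (not a Dirac toy): the large-field Peierls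
# bound of a correlated Gaussian, rank-local and β-free, DERIVED THROUGH `sum_admS_integral_le_of_LCS`

Cell `pub-balaban`, sub-cell `t4`, spine estimate NE7b (`T4WeightBudget.RelWeightBound` — NOT PRINTED, NOT PROVED).  Crux-route
MODEL work under `Spine/NE7b/`; no `T4Continuum/Support` leaf; no `Prop` minted; nothing of [B15]∕[B16] named; no `[cite:]`;
0 `sorry`.

WHY.  `LocalConditionalStability` §5 checks that `hstep` ∧ `PointwiseExtraction` ∧ `LocCondStability` ∧ the cost–volume
inequality are jointly satisfiable on the decided Dirac toy `toyT`.  THIS FILE inhabits the same four displays with a GENUINE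
continuum object: the ONE-STEP GAUSSIAN TOWER on `ι → ℝ` (Lebesgue) — level-0 density `e^{−xᵀAx}` (any positive-definite
precision), step map at the choice `false` = multiplication by the LARGE-FIELD characteristic function `𝟙{θ ≤ xᵀBx}` of the
region's action `B` (`0 ≤ B ≤ A`), at the choice `true` = by its complement (a positive partition of the step — regime (R) of
F353, the letter π-ne7bref-g63-4) — pattern = «pin `false` at step 0».  `PointwiseExtraction` is print's Chebyshev split
(`chebyshev_extraction_single`, exponent `a = δθ`, carrier `M = e^{δxᵀBx}`); `LocCondStability` IS
`GaussianRankLocalMoment.gaussian_model_locCondStability` (exponent `b = rank B·(−log(1−δ)∕2)`); and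
`sum_admS_integral_le_of_LCS` then yields the LARGE-FIELD PEIERLS BOUND
`∫ 𝟙{θ ≤ xᵀBx} e^{−xᵀAx} dx ≤ e^{−(δθ − rank B·(−log(1−δ)∕2))} · ∫ e^{−xᵀAx} dx` — the extracted `e^{−δθ}` against a volume
cost that is EXTENSIVE IN THE REGION (`rank B`), uniform in `|ι|` and in the precision: the cost–volume bookkeeping of the row's
count on a real Gaussian.

WHAT IS PROVED ([folklore]): §1 `mulHom` (multiplication by a non-negative weight as a `RelLinPosHom` of top classes),
`gaussTower`, `pinLarge`; §2 the four displays (`gauss_hstep`, `gauss_hintχ`, `gauss_pointwiseExtraction`,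
`gauss_locCondStability`); §3 **`gauss_classWeight_le`** (the class bound through `sum_admS_integral_le_of_LCS`) and
**`gaussian_largeField_peierls`** (the same in closed form).

NOT HERE (honest).  One step, multiplication operators (kernel = identity): nothing of Bałaban's 𝐑𝐓 steps, fluctuation
integrals, small-field characteristic functions of print's shape, normalisation constants (F353's `log g⁻²` letter), or the
(A1c) instance.  BY-NAME EFFECT ON THE WALL: NONE — a non-vacuity ∕ currency check of the LCS road on a continuum model.
NE7b NOT PRINTED ∕ NOT PROVED; spine PROVED 0∕9; rung (B)+1 on a FINITE torus — NOT infinite volume, NOT the mass gap, NOT Clay.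
HONEST DEPENDENCY: continuum YM on T⁴ ⇐ BetaPertH ∧ nine spine estimates (0/9 proved); BetaPertH ⇐ (D1) ∧ (D4) ∧ CAP+tail;
G-an2-4 gates asym, D1 and NE2/3/4.
-/

set_option autoImplicit false

open MeasureTheory Real Matrix Finset
open Summit.QuantumFields.BalabanUV.T4Continuum.B16HistoryIndexedRepr Summit.QuantumFields.BalabanUV.T4Continuum.B16HistoryReprChain
open Summit.QuantumFields.BalabanUV.T4Continuum.NE7b.PrefixExtraction Summit.QuantumFields.BalabanUV.T4Continuum.NE7b.PrefixExtractionLaws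
open Summit.QuantumFields.BalabanUV.T4Continuum.NE7b.LocalConditionalStability
open Summit.QuantumFields.BalabanUV.T4Continuum.NE7b.GaussianRankLocalMoment

namespace Summit.QuantumFields.BalabanUV.T4Continuum.NE7b.GaussianRankLocalMomentTower

variable {ι : Type} [Fintype ι] [DecidableEq ι]

/-! ## §1 The one-step Gaussian tower -/

/-- **MULTIPLICATION BY A NON-NEGATIVE WEIGHT** as a one-step map between top classes (kernel = the identity: the step
integrates nothing, it only splits the level by a characteristic-function decomposition). [folklore] -/
def mulHom {X : Type} (c : X → ℝ) (hc : ∀ x, 0 ≤ c x) : RelLinPosHom (GoodClass.top X) (GoodClass.top X) where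
  T F := fun x => c x * F x
  map_good _ := trivial
  mono _ _ h x := mul_le_mul_of_nonneg_left (h x) (hc x)
  add _ _ x := mul_add (c x) _ _
  smul _ c' x := mul_left_comm (c x) c' _

omit [DecidableEq ι] in
/-- **THE LARGE-FIELD CHARACTERISTIC FUNCTION** of the region's action at threshold `θ`: `𝟙{θ ≤ xᵀBx}`. [folklore] -/
noncomputable def chiLarge (B : Matrix ι ι ℝ) (θ : ℝ) (x : ι → ℝ) : ℝ := if θ ≤ x ⬝ᵥ (B *ᵥ x) then 1 else 0

omit [DecidableEq ι] in
/-- The step weights: choice `false` = LARGE (`𝟙{θ ≤ xᵀBx}`), choice `true` = SMALL (its complement) — a positive partition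
of the step. [folklore] -/
noncomputable def chi (B : Matrix ι ι ℝ) (θ : ℝ) : Bool → (ι → ℝ) → ℝ
  | false => chiLarge B θ
  | true => fun x => 1 - chiLarge B θ x

omit [DecidableEq ι] in
/-- `0 ≤ 𝟙{θ ≤ xᵀBx} ≤ 1`. [folklore] -/
theorem chiLarge_mem (B : Matrix ι ι ℝ) (θ : ℝ) (x : ι → ℝ) : 0 ≤ chiLarge B θ x ∧ chiLarge B θ x ≤ 1 := by
  unfold chiLarge; split_ifs <;> norm_num

omit [DecidableEq ι] in
/-- The step weights are non-negative. [folklore] -/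
theorem chi_nonneg (B : Matrix ι ι ℝ) (θ : ℝ) (p : Bool) (x : ι → ℝ) : 0 ≤ chi B θ p x := by
  obtain ⟨h0, h1⟩ := chiLarge_mem B θ x
  cases p
  · exact h0
  · show 0 ≤ 1 - chiLarge B θ x
    linarith

omit [DecidableEq ι] in
/-- **THE ONE-STEP GAUSSIAN TOWER**: every level is `ι → ℝ` with the top class; both choices admissible; the step map of a
choice multiplies by its weight. [folklore] -/
noncomputable def gaussTower (B : Matrix ι ι ℝ) (θ : ℝ) : Tower Bool (fun _ => ι → ℝ) (fun _ => GoodClass.top (ι → ℝ)) where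
  branch _ _ := Finset.univ
  op _ _ p := mulHom (chi B θ p) (chi_nonneg B θ p)

/-- **THE PATTERN**: pin the LARGE choice (at every step; only step `0` is used). [folklore] -/
def pinLarge : (j : ℕ) → (Fin j → Bool) → Finset Bool := fun _ _ => {false}

/-! ## §2 The four displays of `sum_admS_integral_le_of_LCS` on the Gaussian tower (cutoff `K = 1`) -/

omit [DecidableEq ι] in
/-- `hstep` with kernel the identity: `∫ (χ_p · f) dvol = ∫ χ_p · f dvol`. [folklore] -/
theorem gauss_hstep (B : Matrix ι ι ℝ) (θ : ℝ) :
    ∀ j g, j < 1 → g ∈ admS (gaussTower B θ) pinLarge j → ∀ p ∈ (gaussTower B θ).branch j g, ∀ f : (ι → ℝ) → ℝ,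
      (GoodClass.top (ι → ℝ)).Gd f →
        ∫ x, ((gaussTower B θ).op j g p).T f x ∂(fun _ => (volume : Measure (ι → ℝ))) (j + 1) =
          ∫ y, chi B θ p y * f y ∂(fun _ => (volume : Measure (ι → ℝ))) j :=
  fun _ _ _ _ _ _ _ _ => rfl

omit [DecidableEq ι] in
/-- `𝟙{θ ≤ xᵀBx} · e^{−xᵀAx}` is integrable (an indicator of an integrable function). [folklore] -/
theorem integrable_chiLarge_mul {A : Matrix ι ι ℝ} (hA : A.PosDef) (B : Matrix ι ι ℝ) (θ : ℝ) :
    Integrable (fun x : ι → ℝ => chiLarge B θ x * exp (-(x ⬝ᵥ (A *ᵥ x)))) := by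
  classical
  have hS : MeasurableSet {x : ι → ℝ | θ ≤ x ⬝ᵥ (B *ᵥ x)} :=
    measurableSet_le measurable_const (by fun_prop : Continuous fun x : ι → ℝ => x ⬝ᵥ (B *ᵥ x)).measurable
  refine ((integrable_exp_neg_qf hA).indicator hS).congr (Filter.Eventually.of_forall fun x => ?_)
  by_cases h : θ ≤ x ⬝ᵥ (B *ᵥ x)
  · simp [Set.indicator, chiLarge, h]
  · simp [Set.indicator, chiLarge, h]

/-- `hintχ`: the weighted level-0 term `χ_p · e^{−xᵀAx}` is integrable for both choices. [folklore] -/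
theorem gauss_hintχ {A : Matrix ι ι ℝ} (hA : A.PosDef) (B : Matrix ι ι ℝ) (θ : ℝ) :
    ∀ j g, j < 1 → g ∈ admS (gaussTower B θ) pinLarge j → ∀ p ∈ (gaussTower B θ).branch j g,
      Integrable (fun y => chi B θ p y * (gaussTower B θ).eterm (fun x => exp (-(x ⬝ᵥ (A *ᵥ x)))) j g y)
        ((fun _ => (volume : Measure (ι → ℝ))) j) := by
  intro j g hj _ p _
  obtain rfl : j = 0 := Nat.lt_one_iff.mp hj
  cases p
  · exact integrable_chiLarge_mul hA B θ
  · have := (integrable_exp_neg_qf hA).sub (integrable_chiLarge_mul hA B θ)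
    refine this.congr (Filter.Eventually.of_forall fun y => ?_)
    show exp (-(y ⬝ᵥ (A *ᵥ y))) - chiLarge B θ y * exp (-(y ⬝ᵥ (A *ᵥ y))) = (1 - chiLarge B θ y) * exp (-(y ⬝ᵥ (A *ᵥ y)))
    ring

omit [DecidableEq ι] in
/-- **`PointwiseExtraction` = print's Chebyshev split**: `𝟙{θ ≤ xᵀBx} ≤ e^{−δθ} · e^{δ xᵀBx}` (`chebyshev_extraction_single`),
exponent `a = δθ`, carrier `M = e^{δxᵀBx}`. [folklore] -/
theorem gauss_pointwiseExtraction (B : Matrix ι ι ℝ) (θ : ℝ) {δ : ℝ} (hδ0 : 0 ≤ δ) :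
    PointwiseExtraction (gaussTower B θ) pinLarge 1 (fun _ _ p => chi B θ p)
      (fun _ _ x => exp (δ * (x ⬝ᵥ (B *ᵥ x)))) (fun _ _ => δ * θ) := by
  intro j g hj _ y
  obtain rfl : j = 0 := Nat.lt_one_iff.mp hj
  show ∑ p ∈ Finset.univ ∩ {false}, chi B θ p y ≤ _
  rw [Finset.univ_inter, Finset.sum_singleton]
  exact chebyshev_extraction_single (chiLarge B θ) (fun x => x ⬝ᵥ (B *ᵥ x)) hδ0 (fun x => (chiLarge_mem B θ x).2)
    (fun x hx => by unfold chiLarge at hx; by_contra h; exact hx (if_neg h)) y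

/-- **`LocCondStability` = `gaussian_model_locCondStability`**: the carrier `e^{δxᵀBx}` is integrable against the level-0 term
and has conditional expectation `≤ e^{rank B·(−log(1−δ)∕2)}` in the term's own state — β-free, rank-local. [folklore] -/
theorem gauss_locCondStability {A B : Matrix ι ι ℝ} (hA : A.PosDef) (hB : B.PosSemidef) (hAB : (A - B).PosSemidef)
    (θ : ℝ) {δ : ℝ} (hδ0 : 0 ≤ δ) (hδ1 : δ < 1) :
    LocCondStability (gaussTower B θ) pinLarge 1 (fun _ => (volume : Measure (ι → ℝ)))
      (fun x => exp (-(x ⬝ᵥ (A *ᵥ x)))) (fun _ _ x => exp (δ * (x ⬝ᵥ (B *ᵥ x))))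
      (fun _ _ => (B.rank : ℝ) * (-Real.log (1 - δ) / 2)) := by
  intro j g hj _
  obtain rfl : j = 0 := Nat.lt_one_iff.mp hj
  exact gaussian_model_locCondStability hA hB hAB hδ0 hδ1

/-! ## §3 The class bound through the row's junction, and its closed form -/

/-- **THE PINNED CLASS's WEIGHT THROUGH `sum_admS_integral_le_of_LCS`** on the Gaussian tower: the four displays and the
cost–volume constant `c = δθ − rank B·(−log(1−δ)∕2)` give `Σ_{h ∈ admS} ∫ eterm 1 h ≤ e^{−c} · ∫ e^{−xᵀAx}`. [folklore] -/
theorem gauss_classWeight_le {A B : Matrix ι ι ℝ} (hA : A.PosDef) (hB : B.PosSemidef) (hAB : (A - B).PosSemidef)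
    (θ : ℝ) {δ : ℝ} (hδ0 : 0 ≤ δ) (hδ1 : δ < 1) :
    ∑ h ∈ admS (gaussTower B θ) pinLarge 1,
        ∫ x, (gaussTower B θ).eterm (fun x => exp (-(x ⬝ᵥ (A *ᵥ x)))) 1 h x ∂(fun _ => (volume : Measure (ι → ℝ))) 1 ≤
      exp (-(δ * θ - (B.rank : ℝ) * (-Real.log (1 - δ) / 2))) *
        ∫ x, (fun x => exp (-(x ⬝ᵥ (A *ᵥ x)))) x ∂(fun _ => (volume : Measure (ι → ℝ))) 0 :=
  sum_admS_integral_le_of_LCS (T := gaussTower B θ) (S := pinLarge) (μ := fun _ => volume) (K := 1)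
    (χ := fun _ _ p => chi B θ p) trivial (fun x => (exp_pos _).le) (gauss_hstep B θ) (gauss_hintχ hA B θ)
    (gauss_pointwiseExtraction B θ hδ0) (gauss_locCondStability hA hB hAB θ hδ0 hδ1)
    (fun h _ => by simp [sumAlong])

omit [DecidableEq ι] in
/-- The pinned class has ONE history (`false` at step 0) and its level-1 term is `𝟙{θ ≤ xᵀBx} · ρ₀`. [folklore] -/
theorem gauss_classWeight_eq (B : Matrix ι ι ℝ) (θ : ℝ) (ρ₀ : (ι → ℝ) → ℝ) :
    ∑ h ∈ admS (gaussTower B θ) pinLarge 1,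
        ∫ x, (gaussTower B θ).eterm ρ₀ 1 h x ∂(fun _ => (volume : Measure (ι → ℝ))) 1 =
      ∫ x : ι → ℝ, chiLarge B θ x * ρ₀ x := by
  rw [sum_admS_succ]
  simp only [admS, Finset.univ_unique, Finset.sum_singleton]
  show ∑ p ∈ Finset.univ ∩ {false}, _ = _
  rw [Finset.univ_inter, Finset.sum_singleton]
  simp only [eterm_snoc]
  rfl

/-- **THE LARGE-FIELD PEIERLS BOUND OF A CORRELATED GAUSSIAN, RANK-LOCAL AND β-FREE** (closed form of `gauss_classWeight_le`):
`∫ 𝟙{θ ≤ xᵀBx} e^{−xᵀAx} dx ≤ e^{−(δθ − rank B·(−log(1−δ)∕2))} · ∫ e^{−xᵀAx} dx` for `A.PosDef`, `0 ≤ B ≤ A`, `0 ≤ δ < 1`.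
Scaling `(A, B, θ) ↦ (βA, βB, βθ)` leaves the volume term untouched: the cost–volume bookkeeping of the row's count on a
real Gaussian. [folklore] -/
theorem gaussian_largeField_peierls {A B : Matrix ι ι ℝ} (hA : A.PosDef) (hB : B.PosSemidef) (hAB : (A - B).PosSemidef)
    (θ : ℝ) {δ : ℝ} (hδ0 : 0 ≤ δ) (hδ1 : δ < 1) :
    ∫ x : ι → ℝ, chiLarge B θ x * exp (-(x ⬝ᵥ (A *ᵥ x))) ≤
      exp (-(δ * θ - (B.rank : ℝ) * (-Real.log (1 - δ) / 2))) * ∫ x : ι → ℝ, exp (-(x ⬝ᵥ (A *ᵥ x))) := by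
  have key := gauss_classWeight_le hA hB hAB θ hδ0 hδ1
  rwa [gauss_classWeight_eq] at key

end Summit.QuantumFields.BalabanUV.T4Continuum.NE7b.GaussianRankLocalMomentTower
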